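import Summits.MatrixMultiplication.MatrixMultiplication.Theorems.FarEdgeDescentContactTrichotomy
import HarnessLib

/-!
# Route `FarEdgeDescent` — the CONTACT TRICHOTOMY of the far-edge profile, II: the atoms and the lineage's leaves

Support module (def-free), continuation of `FarEdgeDescentContactTrichotomy` (Part I: convex analysis of the true
profile `f(x) = ω(1,x,1)`, contacts, and the exhaustion `ω(ℂ) > 2 ⟺ ROUND ∨ TRANSVERSAL ∨ TANGENTIAL`).  Items served:
asides `SmoothProfile` (stmt-MatrixMultiplication-27850), `TameProfile` (stmt-MatrixMultiplication-31917), crux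
`FiniteSaturation` (stmt-MatrixMultiplication-23739); the cut of record and `closes` are unchanged.

* §4 ★ EXACTNESS OF THE REGULARITY LEAF (analytic language ⟺ contact language):
  `(f differentiable at every saturated shape > 1) ⟺ (f differentiable at every first zero > 1) ⟺ ¬TC`
  (`smoothAtZeros_iff_not_transversal`, `firstZeroSmooth_iff_not_transversal`).  Gen 21 proved `TC → f not
  differentiable at β`; the converse `¬TC → f differentiable at every saturated shape` is new and closes the
  «regularity dial» at its floor: the hypothesis of the landed `closes_tameSmoothAtZeros` IS `¬TC`, nothing typed
  lies strictly between.  The flat regularity cut BY NAME: `ω(ℂ) = 2 ⟺ TameProfile ∧ ¬TC ⟺ TameProfile ∧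
  (f differentiable at its saturated shapes)` (`node_tame_notTransversal_iff`, `node_tame_smoothAtZeros_iff`);
  `SmoothProfile` is the strictly stronger everywhere-form (`smoothAtZeros_of_smoothProfile`; strictness = the
  landed `kinkedWorld`).
* §5 CLASSIFICATION OF THE LINEAGE'S LEAVES BY EXCLUDED ATOMS (by name): the record's residual is exactly
  «no contact atom», `(FiniteSaturation → ω = 2) ⟺ ¬W2 ∧ ¬W3` (`residual_iff_no_contact_atom`); every law `X`
  with a landed `FiniteSaturation → X → ω = 2` excludes both contact atoms (`law_excludes_contact_atoms`; instance
  `alc_excludes_contact_atoms` — likewise the asides BoundedDoublingDefect / SummableLogDefect / ExpDoublingDefect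
  through their landed `closes_*`); `TameProfile` excludes W1 and W3 (`tame_excludes`); `SmoothProfile` excludes
  W2 only (the landed `smooth_used`; round and tangential smooth worlds are the landed `roundWorld`, `tangentialWorld`).
  Hence the two exact cuts on record are the two coverings of `{W1, W2, W3}` by two NEC statements
  (`two_covers`): RECORD = `FiniteSaturation ⊔ law` (`{W1} ⊔ {W2,W3}`), REGULARITY = `TameProfile ⊔ ¬TC`
  (`{W1,W3} ⊔ {W2}`).  The atomic form `ω = 2 ⟺ FiniteSaturation ∧ ¬W2 ∧ ¬W3` (`mm_iff_no_atom`) is recorded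
  HONESTLY as a case split (each conjunct is the residual of the other two), not as a node.

Placement [cite: LottiRomani1983, Prop. 4.1, §5] [cite: HuangPan1998, (2.8)] [cite: AlmanLiPratt2026, §8].
Written by the decomp-mm lens-2 planner seat (gen 22); imports only BUILT modules; no new definitions.
-/

set_option linter.dupNamespace false

noncomputable section

namespace Summit.MatrixMultiplication.MatrixMultiplication.Theorems.FarEdgeDescentContactAtoms

open Literature.Computability.AlgebraicComplexity
open Summit.MatrixMultiplication.MatrixMultiplication.Theses.FarEdgeDescent
open Summit.MatrixMultiplication.MatrixMultiplication.Theorems.FarEdgeDescentChord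
open Summit.MatrixMultiplication.MatrixMultiplication.Theorems.FarEdgeDescentTameProfile
open Summit.MatrixMultiplication.MatrixMultiplication.Theorems.FarEdgeDescentSmoothCut
open Summit.MatrixMultiplication.MatrixMultiplication.Theorems.FarEdgeDescentContactTrichotomy
open Filter Topology Set Asymptotics

/-! ## §4 ★ Exactness of the regularity leaf: analytic language ⟺ contact language -/

/-- ★ **`(f differentiable at every saturated shape > 1) ⟺ ¬TC`.**  The hypothesis of the landed
`closes_tameSmoothAtZeros` is EXACTLY the absence of a transversal contact. -/
theorem smoothAtZeros_iff_not_transversal :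
    (∀ b : ℝ, 1 < b → omegaRect ℂ 1 b 1 = b + 1 → DifferentiableAt ℝ (fun y : ℝ => omegaRect ℂ 1 y 1) b) ↔
      ¬ ∃ b a : ℝ, 1 < b ∧ a < 1 ∧ (∀ y : ℝ, b ≤ y → omegaRect ℂ 1 y 1 = y + 1) ∧
        ∀ x : ℝ, 1 ≤ x → x ≤ b → omegaRect ℂ 1 b 1 - a * (b - x) ≤ omegaRect ℂ 1 x 1 := by
  constructor
  · rintro h ⟨b, a, hb, ha, hr, hl⟩
    exact not_differentiableAt_of_transversal hb ha hr hl (h b hb (hr b le_rfl))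
  · intro h b hb hs
    exact (differentiableAt_iff_not_transversalAt hb hs).2 fun ⟨a, ha, hr, hl⟩ => h ⟨b, a, hb, ha, hr, hl⟩

/-- ★ **`(f differentiable at every FIRST zero > 1) ⟺ ¬TC`** — differentiability matters at one shape only. -/
theorem firstZeroSmooth_iff_not_transversal :
    (∀ b : ℝ, 1 < b → omegaRect ℂ 1 b 1 = b + 1 → (∀ x : ℝ, 1 ≤ x → x < b → x + 1 < omegaRect ℂ 1 x 1) →
        DifferentiableAt ℝ (fun y : ℝ => omegaRect ℂ 1 y 1) b) ↔
      ¬ ∃ b a : ℝ, 1 < b ∧ a < 1 ∧ (∀ y : ℝ, b ≤ y → omegaRect ℂ 1 y 1 = y + 1) ∧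
        ∀ x : ℝ, 1 ≤ x → x ≤ b → omegaRect ℂ 1 b 1 - a * (b - x) ≤ omegaRect ℂ 1 x 1 := by
  constructor
  · rintro h ⟨b, a, hb, ha, hr, hl⟩
    have hfz := firstZero_of_transversal ha hr hl
    exact not_differentiableAt_of_transversal hb ha hr hl (h b hb hfz.1 hfz.2)
  · intro h b hb hs _
    exact smoothAtZeros_iff_not_transversal.2 h b hb hs

/-- `SmoothProfile` (differentiability on all of `(1,∞)`) implies differentiability at the saturated shapes; the
converse fails in worlds (the landed `kinkedWorld`: a zero-free profile with a corner). -/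
theorem smoothAtZeros_of_smoothProfile (hD : SmoothProfile) :
    ∀ b : ℝ, 1 < b → omegaRect ℂ 1 b 1 = b + 1 → DifferentiableAt ℝ (fun y : ℝ => omegaRect ℂ 1 y 1) b :=
  fun b hb _ => hD b hb

/-- NEC: `ω = 2 → ¬TC`. -/
theorem not_transversal_of_mm (h : _root_.MatrixMultiplication) :
    ¬ ∃ b a : ℝ, 1 < b ∧ a < 1 ∧ (∀ y : ℝ, b ≤ y → omegaRect ℂ 1 y 1 = y + 1) ∧
      ∀ x : ℝ, 1 ≤ x → x ≤ b → omegaRect ℂ 1 b 1 - a * (b - x) ≤ omegaRect ℂ 1 x 1 :=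
  fun t => not_mm_of_transversal t h

/-- ★ **The flat regularity cut, contact form**: `ω(ℂ) = 2 ⟺ TameProfile ∧ ¬TC`. -/
theorem node_tame_notTransversal_iff :
    _root_.MatrixMultiplication ↔ TameProfile ∧
      ¬ ∃ b a : ℝ, 1 < b ∧ a < 1 ∧ (∀ y : ℝ, b ≤ y → omegaRect ℂ 1 y 1 = y + 1) ∧
        ∀ x : ℝ, 1 ≤ x → x ≤ b → omegaRect ℂ 1 b 1 - a * (b - x) ≤ omegaRect ℂ 1 x 1 :=
  ⟨fun h => ⟨tameProfile_of_mm h, not_transversal_of_mm h⟩, fun h => closes_used (tame_used h.1) h.2⟩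

/-- ★ **The flat regularity cut, analytic form**: `ω(ℂ) = 2 ⟺ TameProfile ∧ (f differentiable at every
saturated shape > 1)` — the weakest regularity statement that pairs with tameness, and (§4) nothing typed lies
strictly between it and `¬TC`. -/
theorem node_tame_smoothAtZeros_iff :
    _root_.MatrixMultiplication ↔ TameProfile ∧
      ∀ b : ℝ, 1 < b → omegaRect ℂ 1 b 1 = b + 1 → DifferentiableAt ℝ (fun y : ℝ => omegaRect ℂ 1 y 1) b := by
  rw [node_tame_notTransversal_iff, smoothAtZeros_iff_not_transversal]

/-! ## §5 Classification of the lineage's leaves by excluded contact atoms -/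

/-- ★ **The record's residual is exactly «no contact atom»**: `(FiniteSaturation → ω = 2) ⟺ ¬W2 ∧ ¬W3`. -/
theorem residual_iff_no_contact_atom :
    (FiniteSaturation → _root_.MatrixMultiplication) ↔
      (¬ ∃ b a : ℝ, 1 < b ∧ a < 1 ∧ (∀ y : ℝ, b ≤ y → omegaRect ℂ 1 y 1 = y + 1) ∧
          ∀ x : ℝ, 1 ≤ x → x ≤ b → omegaRect ℂ 1 b 1 - a * (b - x) ≤ omegaRect ℂ 1 x 1) ∧
      ¬ ∃ b : ℝ, 1 < b ∧ omegaRect ℂ 1 b 1 = b + 1 ∧ (∀ x : ℝ, 1 ≤ x → x < b → x + 1 < omegaRect ℂ 1 x 1) ∧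
          DifferentiableAt ℝ (fun y : ℝ => omegaRect ℂ 1 y 1) b := by
  constructor
  · intro h
    refine ⟨not_transversal_of_residual h, fun hW => ?_⟩
    obtain ⟨b, hb, hs, -, -⟩ := id hW
    exact not_mm_of_tangential hW (h (finiteSaturation_iff_realSaturation.2 ⟨b, hb, hs⟩))
  · rintro ⟨h₂, h₃⟩ hF
    by_contra hS
    rcases not_mm_iff_round_or_transversal_or_tangential.1 hS with h | h | h
    · exact h hF
    · exact h₂ h
    · exact h₃ h

/-- Every LAW of the lineage closes together with `FiniteSaturation`; hence each one excludes BOTH contact atoms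
(and is silent on the round world). -/
theorem law_excludes_contact_atoms {X : Prop} (hX : FiniteSaturation → X → _root_.MatrixMultiplication)
    (hx : X) :
    (¬ ∃ b a : ℝ, 1 < b ∧ a < 1 ∧ (∀ y : ℝ, b ≤ y → omegaRect ℂ 1 y 1 = y + 1) ∧
          ∀ x : ℝ, 1 ≤ x → x ≤ b → omegaRect ℂ 1 b 1 - a * (b - x) ≤ omegaRect ℂ 1 x 1) ∧
      ¬ ∃ b : ℝ, 1 < b ∧ omegaRect ℂ 1 b 1 = b + 1 ∧ (∀ x : ℝ, 1 ≤ x → x < b → x + 1 < omegaRect ℂ 1 x 1) ∧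
          DifferentiableAt ℝ (fun y : ℝ => omegaRect ℂ 1 y 1) b :=
  residual_iff_no_contact_atom.1 fun hF => hX hF hx

/-- Instance: the record's law `AnchoredLogConvexity` excludes both contact atoms (through the route's `closes`). -/
theorem alc_excludes_contact_atoms (hA : AnchoredLogConvexity) :
    (¬ ∃ b a : ℝ, 1 < b ∧ a < 1 ∧ (∀ y : ℝ, b ≤ y → omegaRect ℂ 1 y 1 = y + 1) ∧
          ∀ x : ℝ, 1 ≤ x → x ≤ b → omegaRect ℂ 1 b 1 - a * (b - x) ≤ omegaRect ℂ 1 x 1) ∧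
      ¬ ∃ b : ℝ, 1 < b ∧ omegaRect ℂ 1 b 1 = b + 1 ∧ (∀ x : ℝ, 1 ≤ x → x < b → x + 1 < omegaRect ℂ 1 x 1) ∧
          DifferentiableAt ℝ (fun y : ℝ => omegaRect ℂ 1 y 1) b :=
  law_excludes_contact_atoms (fun hF hA' => closes hF hA') hA

/-- `TameProfile` excludes the round world and the tangential atom (a tame dark world is transversal). -/
theorem tame_excludes (hT : TameProfile) :
    FiniteSaturation ∧
      ¬ ∃ b : ℝ, 1 < b ∧ omegaRect ℂ 1 b 1 = b + 1 ∧ (∀ x : ℝ, 1 ≤ x → x < b → x + 1 < omegaRect ℂ 1 x 1) ∧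
          DifferentiableAt ℝ (fun y : ℝ => omegaRect ℂ 1 y 1) b := by
  refine ⟨finiteSaturation_of_tameProfile hT, fun hW => ?_⟩
  rcases tame_used hT with hS | hTC
  · exact not_mm_of_tangential hW hS
  · exact transversal_tangential_exclusive hTC hW

/-- HONESTY — the atomic form `ω(ℂ) = 2 ⟺ FiniteSaturation ∧ ¬W2 ∧ ¬W3` is a CASE SPLIT (each conjunct is the
residual of the other two), recorded as the common refinement of the two exact cuts, not as a node. -/
theorem mm_iff_no_atom :
    _root_.MatrixMultiplication ↔
      FiniteSaturation ∧
      (¬ ∃ b a : ℝ, 1 < b ∧ a < 1 ∧ (∀ y : ℝ, b ≤ y → omegaRect ℂ 1 y 1 = y + 1) ∧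
          ∀ x : ℝ, 1 ≤ x → x ≤ b → omegaRect ℂ 1 b 1 - a * (b - x) ≤ omegaRect ℂ 1 x 1) ∧
      ¬ ∃ b : ℝ, 1 < b ∧ omegaRect ℂ 1 b 1 = b + 1 ∧ (∀ x : ℝ, 1 ≤ x → x < b → x + 1 < omegaRect ℂ 1 x 1) ∧
          DifferentiableAt ℝ (fun y : ℝ => omegaRect ℂ 1 y 1) b := by
  constructor
  · intro h
    exact ⟨finiteSaturation_of_mm h, residual_iff_no_contact_atom.1 fun _ => h⟩
  · rintro ⟨hF, h⟩
    exact residual_iff_no_contact_atom.2 h hF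

/-- The two exact cuts on record as atom covers: RECORD `ω = 2 ⟺ FiniteSaturation ∧ AnchoredLogConvexity`
(`{W1} ⊔ {W2,W3}`) and REGULARITY `ω = 2 ⟺ TameProfile ∧ ¬TC` (`{W1,W3} ⊔ {W2}`). -/
theorem two_covers :
    (_root_.MatrixMultiplication ↔ FiniteSaturation ∧ AnchoredLogConvexity) ∧
    (_root_.MatrixMultiplication ↔ TameProfile ∧
      ¬ ∃ b a : ℝ, 1 < b ∧ a < 1 ∧ (∀ y : ℝ, b ≤ y → omegaRect ℂ 1 y 1 = y + 1) ∧
        ∀ x : ℝ, 1 ≤ x → x ≤ b → omegaRect ℂ 1 b 1 - a * (b - x) ≤ omegaRect ℂ 1 x 1) :=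
  ⟨node_iff, node_tame_notTransversal_iff⟩

end Summit.MatrixMultiplication.MatrixMultiplication.Theorems.FarEdgeDescentContactAtoms

end
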